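import Summits.HubbardSuperconductivity.HubbardSuperconductivity.Theses.AposterioriCapRg

/-!
# Sketch (crux-ideate round 1, ideator 3) — first lemmas for the idea cards on crux
`FixedPointDWaveOrder` (stmt-HubbardSuperconductivity-1313).

Card `gc-lro-suffices`      : `KtForwardGC`, `DensityFromConcavity`, `GcLroAtBoxPoint`,
                               `fixedPoint_of_gcLro` (proved glue).
Card `handoff-intrinsic-large-n` : `TranslateMeetsFermiCurve` (sector-counting core).
Nothing here is a route item; statements only need to elaborate.
-/

namespace Summit.HubbardSuperconductivity.HubbardSuperconductivity.Cruxes.FixedPointDWaveOrder.Ideator3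

open Filter Set
open scoped Topology Matrix ComplexOrder

open Literature.MathematicalPhysics.QuantumLattice
open Summit.HubbardSuperconductivity.HubbardSuperconductivity.Theses.AposterioriCapRg

/-- KOMA–TASAKI FORWARD DIRECTION, grand-canonical tracial form (card `gc-lro-suffices`, first
lemma). If the tracial ground-state functional of the source-free grand-canonical torus
Hamiltonian `H − μN` has `d`-wave pair-field LRO with density `s²` (in `pairField = √2·Δ_d`
units) eventually in `L`, then the Koma–Tasaki order parameter is at least `s/4`
(true constant `s/√2`; `s/4` is stated to be safe against normalisation slips).
Proof sketch (on paper, 1 page): pick an `N`-eigenstate ground vector `ψ` realising the tracial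
average, trial vector `ψ + ‖Oψ‖⁻¹·Oψ` with `O = pF + pFᴴ`, Rayleigh bound
`E₀(h) ≤ E₀ + ½ε_L − h‖Oψ‖`, `ε_L = ⟨[O,[H,O]]⟩/(2‖Oψ‖²) = O(L⁻²)`, then the concavity chord
`m_L(h) ≥ (E₀(0) − E₀(h))/(2hL²)` for the tracial (supergradient) density. -/
def KtForwardGC : Prop :=
  ∀ (U μ s : ℝ), 0 < s →
    (∃ L₀ : ℕ, ∀ L : ℕ, L₀ ≤ L →
      s ^ 2 * ((L + 1 : ℕ) : ℝ) ^ 4 ≤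
        ((hubbardTorusWith 2 (L + 1) 1 U μ).groundStateFunctional
          ((pairField dWaveFormFactor (L + 1))ᴴ * pairField dWaveFormFactor (L + 1))).re) →
    s / 4 ≤ dWaveOrderParameter U μ

/-- GRIFFITHS' LEMMA FOR THE DENSITY CLAUSE (card `gc-lro-suffices`, second lemma): at every
`μ` where the infinite-volume grand-canonical ground-state energy density `e(U,·)` is
differentiable, the tracial torus densities converge to `−e'(μ)`; so the density clause of
`FixedPointDWaveOrder` holds automatically at differentiability points (all but countably many
`μ`, by concavity), with NO separate thermodynamic-limit theorem for the density. -/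
def DensityFromConcavity : Prop :=
  ∀ (U μ δ : ℝ) (e : ℝ → ℝ), ConcaveOn ℝ Set.univ e →
    (∀ μ' : ℝ, Tendsto (fun L : ℕ =>
        Matrix.groundEnergy (hubbardTorusWith 2 (L + 1) 1 U μ') / ((L + 1 : ℕ) : ℝ) ^ 2)
      atTop (𝓝 (e μ'))) →
    HasDerivAt e (-(1 - δ)) μ →
    Tendsto (fun L : ℕ =>
        ((hubbardTorusWith 2 (L + 1) 1 U μ).groundStateFunctional totalNumber).re /
          ((L + 1 : ℕ) : ℝ) ^ 2)
      atTop (𝓝 (1 - δ))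

/-- THE TRANSFERRED TARGET (card `gc-lro-suffices`): source-free, `h = 0`, tracial grand-canonical
`d`-wave pair LRO at ONE point of the box, with the density clause of the crux verbatim. -/
def GcLroAtBoxPoint : Prop :=
  ∃ U ∈ Set.Icc (2:ℝ) 3, ∃ δ ∈ Set.Icc (1/5:ℝ) (7/20), ∃ μ : ℝ,
    Tendsto (fun L : ℕ =>
        ((hubbardTorusWith 2 (L + 1) 1 U μ).groundStateFunctional totalNumber).re /
          ((L + 1 : ℕ) : ℝ) ^ 2)
      atTop (𝓝 (1 - δ)) ∧
    ∃ s : ℝ, 0 < s ∧ ∃ L₀ : ℕ, ∀ L : ℕ, L₀ ≤ L →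
      s ^ 2 * ((L + 1 : ℕ) : ℝ) ^ 4 ≤
        ((hubbardTorusWith 2 (L + 1) 1 U μ).groundStateFunctional
          ((pairField dWaveFormFactor (L + 1))ᴴ * pairField dWaveFormFactor (L + 1))).re

/-- Glue (provable now): the forward Koma–Tasaki lemma turns GC-LRO at a box point into the
crux. -/
theorem fixedPoint_of_gcLro (hKT : KtForwardGC) (hX : GcLroAtBoxPoint) :
    FixedPointDWaveOrder := by
  obtain ⟨U, hU, δ, hδ, μ, hdens, s, hs, hLRO⟩ := hX
  refine ⟨U, hU, δ, hδ, μ, hdens, ?_⟩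
  have hm : s / 4 ≤ dWaveOrderParameter U μ := hKT U μ s hs hLRO
  exact (hasDWaveOrder_iff U μ).2 (lt_of_lt_of_le (by positivity) hm)

/-- The free square-lattice band at chemical potential `μ₀` (nearest-neighbour hopping `t = 1`). -/
noncomputable def freeBand (μ₀ : ℝ) (k : ℝ × ℝ) : ℝ :=
  -2 * (Real.cos k.1 + Real.cos k.2) - μ₀

/-- SECTOR-COUNTING CORE (card `handoff-intrinsic-large-n`, first lemma): for fillings below
half filling (`μ₀ ∈ (−4,0)`, one strictly convex electron-like Fermi curve — curvature sign
`c(1 − cos k₁ cos k₂) > 0` with `c = −μ₀/2`) and every total momentum `p ∉ 2πℤ²`, at most EIGHT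
momenta `k` of the Fermi curve have `p − k` on the Fermi curve as well (two translates of a
strictly convex closed curve meet at most twice; at most four translates `p + 2πm` are close
enough). This is the geometric fact behind "only particle–particle ladders (total momentum
`p ≈ 0`) carry two free sector sums": the intrinsic `1/N(Λ)` of Feldman–Magnen–Rivasseau–Trubowitz. -/
def TranslateMeetsFermiCurve : Prop :=
  ∀ μ₀ ∈ Set.Ioo (-4:ℝ) 0, ∀ p : ℝ × ℝ,
    (∀ m : ℤ × ℤ, p ≠ (2 * Real.pi * (m.1 : ℝ), 2 * Real.pi * (m.2 : ℝ))) →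
      ({k : ℝ × ℝ | k.1 ∈ Set.Ico (-Real.pi) Real.pi ∧ k.2 ∈ Set.Ico (-Real.pi) Real.pi ∧
          freeBand μ₀ k = 0 ∧ freeBand μ₀ (p - k) = 0}).Finite ∧
      ({k : ℝ × ℝ | k.1 ∈ Set.Ico (-Real.pi) Real.pi ∧ k.2 ∈ Set.Ico (-Real.pi) Real.pi ∧
          freeBand μ₀ k = 0 ∧ freeBand μ₀ (p - k) = 0}).ncard ≤ 8

end Summit.HubbardSuperconductivity.HubbardSuperconductivity.Cruxes.FixedPointDWaveOrder.Ideator3
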